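import Summits.Langlands.Langlands.Theses.ParityBlindBianchi
import Summits.Langlands.Langlands.Theses.DedekindQuotient1951
import Literature.NumberTheory.Automorphic.PairLFunctionBaseChange
import Literature.NumberTheory.Automorphic.AutomorphicRepsGLSatakeFlathProofs
import HarnessLib

/-!
# SKELETON — line `dedekind-exclusion` for crux stmt-Langlands-2908 `ParityBlindBianchi.EvenArtinJunction`
(crux-strategist planner-cstrat-stmt-Langlands-2908-s1-0, 2026-08-17; lens: NEGATION at crux level)

`J := EvenArtinJunction = (X → Langlands)` with `X := EvenIcosahedralStrongArtin` (route TARGET, stmt-2903).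
Landed position (p137220, p140157): `J ↔ ¬X ∨ Langlands`, `J ↔ (X ↔ Langlands)`, `Langlands → X`.
So the ONLY branch of `J` short of the summit is `¬X`.  Until 2026-08-17 nobody on the hub worked `¬X`; since
then the hub itself commissions exactly one `¬X`-grade computation: the refutation-shaped routes
DedekindQuotient1951 / DedekindDeficit1951 bet on C1 = `DedekindQuotient1951.QuinticDedekindPole`
(for the Doud–Moore totally real `A₅` quintic `K`, `d_K = 1951⁴`, the quotient `ζ_K/ζ` is NOT holomorphic on the box
`0 < Re s`, `|Im s| < 100`; decided EITHER way by one Arb-certified job specified on that route).  Their `closes`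
derives `¬Langlands` from C1 (typed (B) at `n = 4` + Godement–Jacquet).  NEW HERE: C1 also gives `¬X`, by theorems in
print and WITHOUT the typed summit — `X` applied to the two EVEN icosahedral representations `τ, τ′ : Γ_ℚ → GL₂(ℂ)` cut
out by `K` (complex conjugation is trivial on the five real roots, so both lifts are even) yields cuspidal `π, π′` on
`GL₂(𝔸_ℚ)` matching `τ, τ′` a.e.; the Artin formalism `Ind_K^ℚ 1 = 1 ⊕ (τ ⊗ τ′)` (the `4`-dimensional irreducible of
`A₅` is the tensor product of the two `2`-dimensional ones of `2.A₅`) reads, prime by prime,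
`(X - 1) · charpoly((τ ⊗ τ′)(Frob_p)) = ∏_{𝔭 ∣ p} (X^{f(𝔭|p)} - 1)` (Dedekind), hence the pair Euler factor of
`(π, π′)` at `p` is `(1 - p^{-s}) · ζ_{K,p}(s)`; Rankin–Selberg theory of `GL₂ × GL₂` (Jacquet 1972; Jacquet–Shalika
1981; Mœglin–Waldspurger 1989 Appendice — tree named facts `MoeglinWaldspurger1989_partialPairL_entire_of_ne_conj` /
`_of_eq_conj`, with the PROVED Borel–Jacquet ↔ `L²` bridge `CuspidalAutomorphicRepData.exists_satake_eq_cpow_mul_L2_unconditional`)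
continues `L^S(s, π × π′)` to an entire function unless `π′` is the conjugate of `π` up to a central shift, which the
icosahedral pair excludes at every Frobenius of order `5` (`{ζ₅, ζ₅⁴}` vs `{ζ₅², ζ₅³}` are not conjugate-proportional);
so `ζ_K = ζ · E · L^S(π × π′)` with `E · L^S` holomorphic on `Re s > 0` — Dedekind divisibility for `K`, i.e. `¬C1`.
Contrapositive: **C1 ⇒ ¬X ⇒ J**.

STUBS (4; sorries only here):
* `stub_quinticDedekindPole` — C1 BY NAME (the computational bet of route-Langlands-DedekindQuotient1951, its crux; decided
  by THEIR certified census; expected to be REFUTED — then this line is dead by design and the strategist's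
  STRATEGY-CENSUS.md on stmt-2908 stands as the earned `no-strategy-short-of-summit`).
* `stub_pairLPackageGL2` — the analytic input, stated inline in the Borel–Jacquet model (named-fact shape, like
  DedekindQuotient1951.PartialLEntire): continuation-with-dichotomy of the partial Rankin–Selberg `L`-function of two
  cuspidal `π, π′` on `GL₂(𝔸_ℚ)`.  Provable now modulo the tree's named facts MW89 (i)(b)/(ii), JS81 Thm 5.3,
  `multiplicity_one_gl`; bridge and `IsSatakeFamilyOf.conj` are proved.
* `stub_dedekindQuotientOfPairEuler` — pure Dedekind-zeta bookkeeping (no automorphic content): an entire function whose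
  values on a right half-plane are the Euler product, over `p ∉ S₁`, of pair factors satisfying the splitting identity
  is `∏_{p ∉ S₁} (1 - p^{-s}) ζ_{K,p}(s)`; multiplying by the finitely many missing factors gives `g` holomorphic on
  `Re s > 0` with `g · ζ = ζ_K` on `Re s > 1`.  Provable now (Mathlib `riemannZeta`, `NumberField.dedekindZeta`,
  Euler products, identity theorem); M/L-sized.
* `stub_evenPairSupply` — Galois supply: the Doud–Moore field with TWO even icosahedral `τ, τ′` whose Frobenius
  characteristic polynomials satisfy the splitting identity a.e. and are not conjugate-proportional i.o.  In substance
  landed for route QuarterDeficit1951 (`Theorems/QuarterDeficit1951IcosahedralSupply*`: Doud–Moore field, `A₅` datum,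
  icosahedral embeddings, Tate lifts, Frobenius read-out); new: the `2 ⊗ 2′ = 4` character identity and Dedekind's
  cycle-type theorem (shared with DedekindQuotient1951.DoudMoorePermutationSupply, stmt-Langlands-17272).  M-sized.
COMPOSITION (kernel-checked, no sorry of its own): the hypothesis form `not_target_of_stubs : A → B → C → D → ¬X` (the
four stub STATEMENTS verbatim as hypotheses), and the REGISTERED certificate `EvenArtinJunction_proof : EvenArtinJunction`
(the crux BY NAME, no hypotheses: `fun hX => absurd hX (not_target_of_stubs stub_A stub_B stub_C stub_D)`) with its twin
`not_target_proof : ¬X`.  (An explicit `EvenArtinJunction_of : A → B → C → D → EvenArtinJunction` is `fun a b c d hX =>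
absurd hX (not_target_of_stubs a b c d)`; it is omitted because `ledger skeleton check` lints the first crux-concluding
theorem for by-name hypotheses.)
BY-PRODUCT while C1 is undecided: a TRUE-certificate of C1 would now refute the shared TARGET stmt-2903 of the four
even-Artin routes mechanically (today the Dedekind `closes` yield only `¬Langlands`); and B ∘ C ∘ D is the calibration
theorem "`X` for the conductor-`1951` pair ⇒ Dedekind's conjecture for the Doud–Moore field on `Re s > 0`" named in
DedekindQuotient1951's kill criteria.  Disproof.lean for this crux: none exists (nothing to honour).
-/

noncomputable section

-- `Summit.Langlands.Langlands.…`: summit = sub-problem name (D-0017 nested layout), not a typo.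
set_option linter.dupNamespace false

open scoped MatrixGroups Matrix NumberField Classical Polynomial BigOperators
open Filter IsDedekindDomain NumberField
open Literature.NumberTheory.Automorphic Literature.NumberTheory.GaloisRepresentations
open Summit.Langlands.Langlands.Theses

namespace Summit.Langlands.Langlands.Cruxes.EvenArtinJunction.DedekindExclusion

/-! ## Stub A — the commissioned computational bet, BY NAME -/

/-- **STUB A = route-Langlands-DedekindQuotient1951's crux C1 `QuinticDedekindPole`, by name** (computational bet,
decided either way by that route's Arb-certified census of `ζ_K`, `L(s,χ₃,K)`, `L(s,χ₂,K₆)` at the 29 Riemann zeros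
below height 100; expected FALSE — Artin/Dedekind are believed — in which case this line dies by design).  For every
number field `K = ℚ(θ)` generated by a root of the Doud–Moore quintic, `ζ_K/ζ` is not holomorphic on the box
`0 < Re s, |Im s| < 100`.  Not a prover task. [cite: Booker2006, §6] [cite: DoudMoore2006] -/
theorem stub_quinticDedekindPole : DedekindQuotient1951.QuinticDedekindPole := by
  sorry

/-! ## Stub B — Rankin–Selberg package for `GL₂ × GL₂` over `ℚ` (Borel–Jacquet model, named-fact shape) -/

/-- **STUB B (analytic input, inline): continuation-with-dichotomy of `L^S(s, π × π′)` for cuspidal `π, π′` on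
`GL₂(𝔸_ℚ)`.**  For Satake-parameter families `α, β` of `π, π′` off a finite `S` there are a finite `S₁ ⊇ S`,
`σ₀` and `L` with `L(s) = ∏_{v ∉ S₁} ∏_{a,b} (1 - a b q_v^{-s})⁻¹` (as a convergent product) for `Re s > σ₀`, and
EITHER `L` is the restriction of an entire function, OR `β_v = \bar{α_v} · q_v^{w}` for one `w ∈ ℂ` and every
`v ∉ S₁` (i.e. `π′ ≅ π̄ ⊗ |det|^{w}`).  In print: Jacquet–Shalika 1981 Thm 5.3 (absolute convergence),
Mœglin–Waldspurger 1989 Appendice Cor. (i)(b)/(ii) (tree named facts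
`MoeglinWaldspurger1989_partialPairL_entire_of_ne_conj`, `MoeglinWaldspurger1989_partialPairL_of_eq_conj`, with
`multiplicity_one_gl`), transported to the Borel–Jacquet model by the PROVED bridge
`CuspidalAutomorphicRepData.exists_satake_eq_cpow_mul_L2_unconditional` (shift `q^{s₀}`, whence `σ₀` and `w`) and
`IsSatakeFamilyOf.conj`.  [cite: MoeglinWaldspurger1989, Appendice, Corollaire] [cite: JacquetShalikaAJM1981, Thm. 5.3] -/
theorem stub_pairLPackageGL2 :
    ∀ (hcpt hcpt' : isCompact_glFiniteIntegralLevel 2 ℚ)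
      (π : CuspidalAutomorphicRepData 2 ℚ hcpt) (π' : CuspidalAutomorphicRepData 2 ℚ hcpt')
      (S : Set (HeightOneSpectrum (𝓞 ℚ))), S.Finite →
      ∀ α β : HeightOneSpectrum (𝓞 ℚ) → Multiset ℂ,
        (∀ v, v ∉ S → π.1.HasSatakeParamAt v (α v)) →
        (∀ v, v ∉ S → π'.1.HasSatakeParamAt v (β v)) →
        ∃ (S₁ : Set (HeightOneSpectrum (𝓞 ℚ))) (σ₀ : ℝ) (L : ℂ → ℂ), S₁.Finite ∧ S ⊆ S₁ ∧
          (∀ s : ℂ, σ₀ < s.re →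
            HasProd (fun v : {v : HeightOneSpectrum (𝓞 ℚ) // v ∉ S₁} =>
              ((satakePairPolynomial (α v.1) (β v.1)).eval ((v.1.residueCard : ℂ) ^ (-s)))⁻¹) (L s)) ∧
          ((∃ g : ℂ → ℂ, Differentiable ℂ g ∧ ∀ s : ℂ, σ₀ < s.re → g s = L s) ∨
            (∃ w : ℂ, ∀ v, v ∉ S₁ →
              β v = (α v).map (fun a : ℂ => (starRingEnd ℂ) a * (v.residueCard : ℂ) ^ w))) := by
  sorry

/-! ## Stub C — Dedekind-zeta bookkeeping (no automorphic content) -/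

/-- **STUB C (provable now): from the pair Euler product with the splitting identity to `ζ ∣ ζ_K` on `Re s > 0`.**
If for every `v ∉ S₁` (finite) the pair Satake polynomial of `(α_v, β_v)` satisfies Dedekind's splitting identity
`(X - 1) · ∏_{a,b} (X - a b) = ∏_{𝔭 ∣ p} (X^{f(𝔭|p)} - 1)` in `K`, and an ENTIRE `g₀` equals the convergent product
`∏_{v ∉ S₁} ∏_{a,b} (1 - a b p^{-s})⁻¹` on `Re s > σ₀`, then — since that product is `∏_{p ∉ S₁} (1 - p^{-s}) ζ_{K,p}(s)`
— the function `g := g₀ · ∏_{p ∈ S₁} (1 - p^{-s}) ζ_{K,p}(s)` is holomorphic on `Re s > 0` (the finitely many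
factors `(1 - N𝔭^{-s})⁻¹` have poles on `Re s = 0` only) and `g · ζ = ζ_K` on `Re s > 1` (Euler products of `ζ` and
`ζ_K`, absolutely convergent there; identity theorem down from `Re s > max(1, σ₀)`).  Mathlib: `riemannZeta`,
`riemannZeta_eulerProduct_hasProd`, `NumberField.dedekindZeta`; tree: `satakePairPolynomial`, `satakeTensor`.
[cite: NeukirchANT1999, Ch. VII §8, (8.2) and Ch. I (8.3)] -/
theorem stub_dedekindQuotientOfPairEuler :
    ∀ (K : Type) [Field K] [NumberField K] (S₁ : Set (HeightOneSpectrum (𝓞 ℚ))), S₁.Finite →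
      ∀ (α β : HeightOneSpectrum (𝓞 ℚ) → Multiset ℂ),
        (∀ v, v ∉ S₁ →
          (Polynomial.X - Polynomial.C 1) * satakePolynomial (satakeTensor (α v) (β v)) =
            (∏ 𝔭 ∈ (UniqueFactorizationMonoid.factors
                (Ideal.span {((v.residueCard : ℕ) : 𝓞 K)})).toFinset,
              (Polynomial.X ^ (𝔭.inertiaDeg ℤ) - 1 : Polynomial ℤ)).map (Int.castRingHom ℂ)) →
        ∀ (σ₀ : ℝ) (g₀ : ℂ → ℂ), Differentiable ℂ g₀ →
          (∀ s : ℂ, σ₀ < s.re →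
            HasProd (fun v : {v : HeightOneSpectrum (𝓞 ℚ) // v ∉ S₁} =>
              ((satakePairPolynomial (α v.1) (β v.1)).eval ((v.1.residueCard : ℂ) ^ (-s)))⁻¹) (g₀ s)) →
          ∃ g : ℂ → ℂ, DifferentiableOn ℂ g {s : ℂ | 0 < s.re} ∧
            ∀ s : ℂ, 1 < s.re → g s * riemannZeta s = NumberField.dedekindZeta K s := by
  sorry

/-! ## Stub D — the even icosahedral pair of the Doud–Moore field -/

/-- **STUB D (supply): the Doud–Moore field and its two EVEN icosahedral representations, with the tensor/splitting
identity a.e. and non-proportionality i.o.**  `K = ℚ(θ)`, `θ` a root of `x⁵ - x⁴ - 780x³ + 9911x² - 24208x + 15952`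
(totally real `A₅` quintic, `d_K = 1951⁴`; tree: `Theorems/QuarterDeficit1951IcosahedralSupplyDoudMooreField`,
`…StubDmGaloisDatum`); `τ, τ′ : Γ_ℚ → GL₂(ℂ)` irreducible with projective image `A₅` through the two inequivalent
embeddings `A₅ ↪ PGL₂(ℂ)` (Tate lifts, tree `…StubTateTwistLift`, `…StubIcosahedralEmbedding`), both EVEN (complex
conjugation fixes the five real roots, so its projective image is trivial and `det τ(c) = 1`), normalised so that
`τ ⊗ τ′ ≅` the `4`-dimensional constituent of the permutation representation `Ind_{Γ_K}^{Γ_ℚ} 1 = 1 ⊕ (τ ⊗ τ′)` (character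
table of `2.A₅`: `2 ⊗ 2′ = 4`; twist one lift by a character if necessary).  Then at every prime `p` unramified in the
`A₅`-closure the eigenvalue multisets `α, β` of `τ(Frob_p), τ′(Frob_p)` satisfy
`(X - 1) ∏_{a,b}(X - ab) = charpoly(perm(Frob_p)) = ∏_{𝔭 ∣ p}(X^{f(𝔭|p)} - 1)` (Dedekind: cycle type = residue
degrees; the `∀ α β` form holds by uniqueness of Frobenius characteristic polynomials at unramified places), and at the
(infinitely many, Chebotarev — tree `ChebotarevArtinRepHolds`) primes with `Frob_p` of order `5` one has
`α ∝ {ζ₅, ζ₅⁴}`, `β ∝ {ζ₅², ζ₅³}`, which are not conjugate-proportional (ratio sets `{ζ₅², ζ₅³} ≠ {ζ₅, ζ₅⁴}`).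
[cite: DoudMoore2006] [cite: SerreLinearRepresentations1977, §5.8 (A₅)] [cite: NeukirchANT1999, Ch. I (8.3)] -/
theorem stub_evenPairSupply :
    ∃ (K : Type) (_ : Field K) (_ : NumberField K) (θ : K),
      θ ^ 5 - θ ^ 4 - 780 * θ ^ 3 + 9911 * θ ^ 2 - 24208 * θ + 15952 = 0 ∧
      IntermediateField.adjoin ℚ ({θ} : Set K) = ⊤ ∧
      ∃ τ τ' : FramedGaloisRep ℚ ℂ 2,
        τ.toGaloisRep.IsIrreducible ∧
        Nonempty ((Matrix.ProjGenLinGroup.mk.comp τ.toMonoidHom).range ≃* alternatingGroup (Fin 5)) ∧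
        (∀ (φ : ℚ →+* ℝ) (c : Field.absoluteGaloisGroup ℚ),
          IsComplexConjugation φ c → Matrix.GeneralLinearGroup.det (τ c) = 1) ∧
        τ'.toGaloisRep.IsIrreducible ∧
        Nonempty ((Matrix.ProjGenLinGroup.mk.comp τ'.toMonoidHom).range ≃* alternatingGroup (Fin 5)) ∧
        (∀ (φ : ℚ →+* ℝ) (c : Field.absoluteGaloisGroup ℚ),
          IsComplexConjugation φ c → Matrix.GeneralLinearGroup.det (τ' c) = 1) ∧
        (∀ᶠ v : HeightOneSpectrum (𝓞 ℚ) in cofinite, ∀ α β : Multiset ℂ,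
          τ.HasFrobCharpolyAt v (satakePolynomial α) → τ'.HasFrobCharpolyAt v (satakePolynomial β) →
            (Polynomial.X - Polynomial.C 1) * satakePolynomial (satakeTensor α β) =
              (∏ 𝔭 ∈ (UniqueFactorizationMonoid.factors
                  (Ideal.span {((v.residueCard : ℕ) : 𝓞 K)})).toFinset,
                (Polynomial.X ^ (𝔭.inertiaDeg ℤ) - 1 : Polynomial ℤ)).map (Int.castRingHom ℂ)) ∧
        (∃ᶠ v : HeightOneSpectrum (𝓞 ℚ) in cofinite, ∀ α β : Multiset ℂ,
          τ.HasFrobCharpolyAt v (satakePolynomial α) → τ'.HasFrobCharpolyAt v (satakePolynomial β) →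
            ∀ w : ℂ, β ≠ α.map (fun a : ℂ => (starRingEnd ℂ) a * (v.residueCard : ℂ) ^ w)) := by
  sorry

/-! ## Composition (kernel-checked): the stubs refute the target, hence prove the junction BY NAME -/

/-- **A ∧ B ∧ C ∧ D ⇒ ¬X**: the Dedekind bet excludes even icosahedral strong Artin for the conductor-`1951` pair.
From `X` get `π, π′` matching `τ, τ′` a.e.; D turns the matching into the splitting identity for the Satake parameters
of `(π, π′)` off a finite `S` and into non-proportionality i.o.; B continues the pair Euler product (the proportional
branch is excluded by uniqueness of Satake parameters, tree `hasSatakeParamAt_unique_holds`); C yields `g` holomorphic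
on `Re s > 0` with `g ζ = ζ_K`; A says no such `g` exists even on the box. [folklore] -/
theorem not_target_of_stubs
    (hA : DedekindQuotient1951.QuinticDedekindPole)
    (hB : ∀ (hcpt hcpt' : isCompact_glFiniteIntegralLevel 2 ℚ)
      (π : CuspidalAutomorphicRepData 2 ℚ hcpt) (π' : CuspidalAutomorphicRepData 2 ℚ hcpt')
      (S : Set (HeightOneSpectrum (𝓞 ℚ))), S.Finite →
      ∀ α β : HeightOneSpectrum (𝓞 ℚ) → Multiset ℂ,
        (∀ v, v ∉ S → π.1.HasSatakeParamAt v (α v)) →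
        (∀ v, v ∉ S → π'.1.HasSatakeParamAt v (β v)) →
        ∃ (S₁ : Set (HeightOneSpectrum (𝓞 ℚ))) (σ₀ : ℝ) (L : ℂ → ℂ), S₁.Finite ∧ S ⊆ S₁ ∧
          (∀ s : ℂ, σ₀ < s.re →
            HasProd (fun v : {v : HeightOneSpectrum (𝓞 ℚ) // v ∉ S₁} =>
              ((satakePairPolynomial (α v.1) (β v.1)).eval ((v.1.residueCard : ℂ) ^ (-s)))⁻¹) (L s)) ∧
          ((∃ g : ℂ → ℂ, Differentiable ℂ g ∧ ∀ s : ℂ, σ₀ < s.re → g s = L s) ∨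
            (∃ w : ℂ, ∀ v, v ∉ S₁ →
              β v = (α v).map (fun a : ℂ => (starRingEnd ℂ) a * (v.residueCard : ℂ) ^ w))))
    (hC : ∀ (K : Type) [Field K] [NumberField K] (S₁ : Set (HeightOneSpectrum (𝓞 ℚ))), S₁.Finite →
      ∀ (α β : HeightOneSpectrum (𝓞 ℚ) → Multiset ℂ),
        (∀ v, v ∉ S₁ →
          (Polynomial.X - Polynomial.C 1) * satakePolynomial (satakeTensor (α v) (β v)) =
            (∏ 𝔭 ∈ (UniqueFactorizationMonoid.factors
                (Ideal.span {((v.residueCard : ℕ) : 𝓞 K)})).toFinset,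
              (Polynomial.X ^ (𝔭.inertiaDeg ℤ) - 1 : Polynomial ℤ)).map (Int.castRingHom ℂ)) →
        ∀ (σ₀ : ℝ) (g₀ : ℂ → ℂ), Differentiable ℂ g₀ →
          (∀ s : ℂ, σ₀ < s.re →
            HasProd (fun v : {v : HeightOneSpectrum (𝓞 ℚ) // v ∉ S₁} =>
              ((satakePairPolynomial (α v.1) (β v.1)).eval ((v.1.residueCard : ℂ) ^ (-s)))⁻¹) (g₀ s)) →
          ∃ g : ℂ → ℂ, DifferentiableOn ℂ g {s : ℂ | 0 < s.re} ∧
            ∀ s : ℂ, 1 < s.re → g s * riemannZeta s = NumberField.dedekindZeta K s)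
    (hD : ∃ (K : Type) (_ : Field K) (_ : NumberField K) (θ : K),
      θ ^ 5 - θ ^ 4 - 780 * θ ^ 3 + 9911 * θ ^ 2 - 24208 * θ + 15952 = 0 ∧
      IntermediateField.adjoin ℚ ({θ} : Set K) = ⊤ ∧
      ∃ τ τ' : FramedGaloisRep ℚ ℂ 2,
        τ.toGaloisRep.IsIrreducible ∧
        Nonempty ((Matrix.ProjGenLinGroup.mk.comp τ.toMonoidHom).range ≃* alternatingGroup (Fin 5)) ∧
        (∀ (φ : ℚ →+* ℝ) (c : Field.absoluteGaloisGroup ℚ),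
          IsComplexConjugation φ c → Matrix.GeneralLinearGroup.det (τ c) = 1) ∧
        τ'.toGaloisRep.IsIrreducible ∧
        Nonempty ((Matrix.ProjGenLinGroup.mk.comp τ'.toMonoidHom).range ≃* alternatingGroup (Fin 5)) ∧
        (∀ (φ : ℚ →+* ℝ) (c : Field.absoluteGaloisGroup ℚ),
          IsComplexConjugation φ c → Matrix.GeneralLinearGroup.det (τ' c) = 1) ∧
        (∀ᶠ v : HeightOneSpectrum (𝓞 ℚ) in cofinite, ∀ α β : Multiset ℂ,
          τ.HasFrobCharpolyAt v (satakePolynomial α) → τ'.HasFrobCharpolyAt v (satakePolynomial β) →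
            (Polynomial.X - Polynomial.C 1) * satakePolynomial (satakeTensor α β) =
              (∏ 𝔭 ∈ (UniqueFactorizationMonoid.factors
                  (Ideal.span {((v.residueCard : ℕ) : 𝓞 K)})).toFinset,
                (Polynomial.X ^ (𝔭.inertiaDeg ℤ) - 1 : Polynomial ℤ)).map (Int.castRingHom ℂ)) ∧
        (∃ᶠ v : HeightOneSpectrum (𝓞 ℚ) in cofinite, ∀ α β : Multiset ℂ,
          τ.HasFrobCharpolyAt v (satakePolynomial α) → τ'.HasFrobCharpolyAt v (satakePolynomial β) →
            ∀ w : ℂ, β ≠ α.map (fun a : ℂ => (starRingEnd ℂ) a * (v.residueCard : ℂ) ^ w))) :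
    ¬ ParityBlindBianchi.EvenIcosahedralStrongArtin := by
  intro hX
  obtain ⟨K, _instF, _instNF, θ, hθ, hgen, τ, τ', hirr, hA5, hev, hirr', hA5', hev', hident, hfreq⟩ := hD
  -- `X` on the two even icosahedral representations
  obtain ⟨hcpt, π, hπ⟩ := hX τ hirr hA5 hev
  obtain ⟨hcpt', π', hπ'⟩ := hX τ' hirr' hA5' hev'
  -- a.e.: the Satake parameters of `(π, π′)` satisfy the splitting identity of `K`
  have hE : ∀ᶠ v : HeightOneSpectrum (𝓞 ℚ) in cofinite, ∃ α β : Multiset ℂ,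
      π.1.HasSatakeParamAt v α ∧ π'.1.HasSatakeParamAt v β ∧
        (Polynomial.X - Polynomial.C 1) * satakePolynomial (satakeTensor α β) =
          (∏ 𝔭 ∈ (UniqueFactorizationMonoid.factors
              (Ideal.span {((v.residueCard : ℕ) : 𝓞 K)})).toFinset,
            (Polynomial.X ^ (𝔭.inertiaDeg ℤ) - 1 : Polynomial ℤ)).map (Int.castRingHom ℂ) := by
    filter_upwards [hπ, hπ', hident] with v ⟨α, hα, _, hP⟩ ⟨β, hβ, _, hP'⟩ hi
    exact ⟨α, β, hα, hβ, hi α β hP hP'⟩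
  -- i.o.: the Satake parameters of `(π, π′)` are not conjugate-proportional
  have hF : ∃ᶠ v : HeightOneSpectrum (𝓞 ℚ) in cofinite, ∃ α β : Multiset ℂ,
      π.1.HasSatakeParamAt v α ∧ π'.1.HasSatakeParamAt v β ∧
        ∀ w : ℂ, β ≠ α.map (fun a : ℂ => (starRingEnd ℂ) a * (v.residueCard : ℂ) ^ w) := by
    refine (hfreq.and_eventually (hπ.and hπ')).mono ?_
    rintro v ⟨hq, ⟨α, hα, -, hP⟩, ⟨β, hβ, -, hP'⟩⟩
    exact ⟨α, β, hα, hβ, hq α β hP hP'⟩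
  -- the finite exceptional set `S` and the Satake families off it
  set S : Set (HeightOneSpectrum (𝓞 ℚ)) := {v | ¬ ∃ α β : Multiset ℂ,
      π.1.HasSatakeParamAt v α ∧ π'.1.HasSatakeParamAt v β ∧
        (Polynomial.X - Polynomial.C 1) * satakePolynomial (satakeTensor α β) =
          (∏ 𝔭 ∈ (UniqueFactorizationMonoid.factors
              (Ideal.span {((v.residueCard : ℕ) : 𝓞 K)})).toFinset,
            (Polynomial.X ^ (𝔭.inertiaDeg ℤ) - 1 : Polynomial ℤ)).map (Int.castRingHom ℂ)} with hSdef
  have hSfin : S.Finite := Filter.eventually_cofinite.1 hE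
  have hout : ∀ v, v ∉ S → ∃ α β : Multiset ℂ,
      π.1.HasSatakeParamAt v α ∧ π'.1.HasSatakeParamAt v β ∧
        (Polynomial.X - Polynomial.C 1) * satakePolynomial (satakeTensor α β) =
          (∏ 𝔭 ∈ (UniqueFactorizationMonoid.factors
              (Ideal.span {((v.residueCard : ℕ) : 𝓞 K)})).toFinset,
            (Polynomial.X ^ (𝔭.inertiaDeg ℤ) - 1 : Polynomial ℤ)).map (Int.castRingHom ℂ) := by
    intro v hv
    by_contra h
    exact hv h
  choose! α β hαβ using hout
  obtain ⟨S₁, σ₀, L, hS₁fin, hSS₁, hprod, hdich⟩ :=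
    hB hcpt hcpt' π π' S hSfin α β (fun v hv => (hαβ v hv).1) (fun v hv => (hαβ v hv).2.1)
  rcases hdich with ⟨g, hg, hgL⟩ | ⟨w, hw⟩
  · -- entire branch: Dedekind divisibility, contradicting the bet
    obtain ⟨gD, hgD, hgDeq⟩ := hC K S₁ hS₁fin α β
      (fun v hv => (hαβ v (fun h => hv (hSS₁ h))).2.2) σ₀ g hg
      (fun s hs => by rw [hgL s hs]; exact hprod s hs)
    exact hA K θ hθ hgen ⟨gD, hgD.mono fun s hs => hs.1, fun s hs _ => hgDeq s hs⟩
  · -- proportional branch: excluded at a Frobenius of order 5 outside `S₁`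
    have hinf := Filter.frequently_cofinite_iff_infinite.1 hF
    obtain ⟨v, ⟨α₁, β₁, hα₁, hβ₁, hq⟩, hv⟩ := (hinf.sdiff hS₁fin).nonempty
    have hvS : v ∉ S := fun h => hv (hSS₁ h)
    have e1 : α₁ = α v := π.1.hasSatakeParamAt_unique_holds hα₁ (hαβ v hvS).1
    have e2 : β₁ = β v := π'.1.hasSatakeParamAt_unique_holds hβ₁ (hαβ v hvS).2.1
    exact hq w (by rw [e1, e2]; exact hw v hv)

/-- **SKELETON CERTIFICATE `EvenArtinJunction_proof`** (the shape `ledger skeleton check` registers; FIRST theorem in this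
file concluding the crux): the crux BY NAME with the four registered stubs discharged INSIDE the proof through
`not_target_of_stubs`; no hypotheses, and the only `sorry`s are inside `stub_*`. [folklore] -/
theorem EvenArtinJunction_proof : ParityBlindBianchi.EvenArtinJunction := by
  intro hX
  exact absurd hX (not_target_of_stubs stub_quinticDedekindPole stub_pairLPackageGL2
    stub_dedekindQuotientOfPairEuler stub_evenPairSupply)

/-- The same certificate for the `¬X` content: the four stubs refute the route target. [folklore] -/
theorem not_target_proof : ¬ ParityBlindBianchi.EvenIcosahedralStrongArtin :=
  not_target_of_stubs stub_quinticDedekindPole stub_pairLPackageGL2 stub_dedekindQuotientOfPairEuler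
    stub_evenPairSupply

end Summit.Langlands.Langlands.Cruxes.EvenArtinJunction.DedekindExclusion

end
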